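import Literature.AlgebraicGeometry.ModuliOfAbelianVarieties.SiegelFamilyHodgeGroup
import Literature.Geometry.Kaehler.ComplexTorusHodgeGroupFunctoriality
import HarnessLib

/-!
# Prop. 7.3.2 for every polarisation type: `Hg(X^δ_Z) = Sp(V, E)` off the same meagre subset of `𝔥_g`

Layer `Literature/AlgebraicGeometry/ModuliOfAbelianVarieties`, namespace
`Literature.AlgebraicGeometry.ModuliOfAbelianVarieties.SiegelModuli`; lane `lit-hodgefound` (Track 2 foundations),
Layer A4, add-only sequel (FILE 2) of row **A4-57** of `run/shared/lean/pub/lit-hodgefound/SKELETON.md`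
(§A4-DETAIL); THEOREMS ONLY (no definition, no named fact). Sequel of `SiegelFamilyHodgeGroup` (Prop. 7.3.2 for
the PRINCIPAL Siegel family: `hodgeGroup (prinPeriod Z) = spGroup (prinPeriod Z) (prinForm Z)` for `Z` off the
meagre set `hodgeGroupExceptionalLocus g`) and of `Geometry/Kaehler/ComplexTorusHodgeGroupFunctoriality` (isogeny
invariance of the Hodge group: `hodgeGroup_eq_map_conjSL`, `Hg(X₂)(ℝ) = P · Hg(X₁)(ℝ) · Q` for mutually inverse
rational homomorphisms).

**Source.** H. Lange, *Abelian Varieties over the Complex Numbers* (2023), §7.3.1 Prop. 7.3.2, p. 336: "For a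
general polarized abelian variety `(X, E)`, `Hg(X) = Sp(V, E)`" — stated for polarized abelian varieties of an
arbitrary (fixed) type `D`, "general" referring to "the moduli space of polarized abelian varieties of a fixed
type" (p. 336 L7–L8); and §7.3.3 Exercise (1)(a), p. 341 (isogenies identify Hodge classes; here: Hodge groups).

**This file** transfers Prop. 7.3.2 from the principal torus `X_Z = ℂ^g/(Z, 1_g)ℤ^{2g}` to the torus
`X^δ_Z = ℂ^g/(Z, Δ)ℤ^{2g}` of type `δ` AT THE SAME `Z ∈ 𝔥_g`: the two markings differ by the rational matrix
`diag(1, Δ)` (`Φ^δ_Z = Φ_Z ∘ diag(1, Δ)`, an isogeny given by the identity of `ℂ^g`), so both the Hodge group and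
the symplectic group of `X^δ_Z` are the `diag(1, Δ)`-conjugates of those of `X_Z` inside `SL_{2g}(ℝ)`
(`hodgeGroup_eq_map_conjSL` with `P = diag(1, Δ)⁻¹ ∈ Hom_ℚ(X_Z, X^δ_Z)`; `spGroup_siegelPeriodEquiv_eq_map`), and
`Hg(X^δ_Z) = Sp(V, E) ⟺ Hg(X_Z) = Sp(V, E)` (`hodgeGroup_eq_spGroup_type_iff`). Hence
**`hodgeGroup_eq_spGroup_of_not_mem_type`**: for every type `δ` and every `Z ∉ 𝒩_Hg` (residual, dense complement
by `SiegelFamilyHodgeGroup`), `Hg(X^δ_Z) = Sp(V, E)`; and Lange's route to Thm. 7.3.1 for every type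
(`mattuck_type_of_not_mem_hodgeGroupExceptionalLocus`, via p17's Prop. 7.3.3).

## Contents

* `analyticRepReal_siegelPeriodEquiv` — `ρ^δ(B) = ρ(diag(1,Δ) B diag(1,Δ)⁻¹)`.
* `spGroup_siegelPeriodEquiv_eq_map` — `Sp` in the type-`δ` marking is the conjugate of `Sp` in the principal one.
* `hodgeGroup_eq_spGroup_type_iff`, `hodgeGroup_eq_spGroup_of_not_mem_type`,
  `mattuck_type_of_not_mem_hodgeGroupExceptionalLocus`.

## References

* [Lange2023AbelianVarietiesComplex] H. Lange, *Abelian Varieties over the Complex Numbers* (2023), §7.3.1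
  Prop. 7.3.2, Prop. 7.3.3, Thm. 7.3.1 (pp. 336–337); §3.1.2 (3.2) (p. 159); §7.3.3 Exercise (1)(a) (p. 341).
-/

noncomputable section

open Matrix Complex Module Function Set Filter Topology

namespace Literature.AlgebraicGeometry.ModuliOfAbelianVarieties

namespace SiegelModuli

open Literature.NumberTheory.Automorphic (siegelUpperHalfSpace)
open Literature.NumberTheory.ModularForms.SiegelUpperHalfSpace
open Literature.Geometry.Kaehler Literature.Geometry.Kaehler.ComplexTorus

variable {g : ℕ} {δ : Fin g → ℕ} (hδ : ∀ i, 0 < δ i)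

/-- The real matrix `diag(1, Δ)` as the cast of the rational one. [folklore] -/
private theorem fromBlocks_diag_map_ratCast (δ : Fin g → ℕ) :
    (Matrix.fromBlocks 1 0 0 (Matrix.diagonal fun i ↦ (δ i : ℚ)) : Matrix (Fin g ⊕ Fin g) (Fin g ⊕ Fin g) ℚ).map
        (Rat.cast : ℚ → ℝ) = (typeDiagInt δ).map (Int.cast : ℤ → ℝ) := by
  rw [typeDiagInt, Matrix.fromBlocks_map, Matrix.fromBlocks_map]
  have h1 : (1 : Matrix (Fin g) (Fin g) ℚ).map (Rat.cast : ℚ → ℝ) = 1 := Matrix.map_one _ Rat.cast_zero Rat.cast_one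
  have h1' : (1 : Matrix (Fin g) (Fin g) ℤ).map (Int.cast : ℤ → ℝ) = 1 := Matrix.map_one _ Int.cast_zero Int.cast_one
  have h0 : (0 : Matrix (Fin g) (Fin g) ℚ).map (Rat.cast : ℚ → ℝ) = 0 := Matrix.map_zero _ Rat.cast_zero
  have h0' : (0 : Matrix (Fin g) (Fin g) ℤ).map (Int.cast : ℤ → ℝ) = 0 := Matrix.map_zero _ Int.cast_zero
  rw [h1, h1', h0, h0', Matrix.diagonal_map Rat.cast_zero, Matrix.diagonal_map Int.cast_zero]
  congr 1

/-- The real matrix `diag(1, Δ⁻¹)`. [folklore] -/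
private theorem fromBlocks_diagInv_map_ratCast (δ : Fin g → ℕ) :
    (Matrix.fromBlocks 1 0 0 (Matrix.diagonal fun i ↦ (δ i : ℚ)⁻¹) : Matrix (Fin g ⊕ Fin g) (Fin g ⊕ Fin g) ℚ).map
        (Rat.cast : ℚ → ℝ) = Matrix.fromBlocks 1 0 0 (Matrix.diagonal fun i ↦ (δ i : ℝ)⁻¹) := by
  rw [Matrix.fromBlocks_map, Matrix.map_one _ Rat.cast_zero Rat.cast_one, Matrix.map_zero _ Rat.cast_zero,
    Matrix.diagonal_map Rat.cast_zero]
  congr 1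
  all_goals (funext i; simp)

include hδ in
/-- `diag(1, Δ) · diag(1, Δ⁻¹) = 1` over `ℝ`. [folklore] -/
private theorem typeDiag_mul_inv :
    (typeDiagInt δ).map (Int.cast : ℤ → ℝ) * Matrix.fromBlocks 1 0 0 (Matrix.diagonal fun i ↦ (δ i : ℝ)⁻¹) = 1 := by
  rw [typeDiagInt, Matrix.fromBlocks_map, Matrix.map_one _ Int.cast_zero Int.cast_one, Matrix.map_zero _ Int.cast_zero,
    Matrix.diagonal_map Int.cast_zero, Matrix.fromBlocks_multiply, ← Matrix.fromBlocks_one]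
  simp only [Matrix.mul_one, Matrix.mul_zero, Matrix.zero_mul, add_zero, zero_add,
    Matrix.diagonal_mul_diagonal, Int.cast_natCast]
  congr 1
  rw [← Matrix.diagonal_one]
  congr 1
  funext i
  exact mul_inv_cancel₀ (Nat.cast_ne_zero.2 (hδ i).ne')

include hδ in
/-- `diag(1, Δ⁻¹) · diag(1, Δ) = 1` over `ℝ`. [folklore] -/
private theorem inv_mul_typeDiag :
    Matrix.fromBlocks 1 0 0 (Matrix.diagonal fun i ↦ (δ i : ℝ)⁻¹) * (typeDiagInt δ).map (Int.cast : ℤ → ℝ) = 1 := by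
  rw [typeDiagInt, Matrix.fromBlocks_map, Matrix.map_one _ Int.cast_zero Int.cast_one, Matrix.map_zero _ Int.cast_zero,
    Matrix.diagonal_map Int.cast_zero, Matrix.fromBlocks_multiply, ← Matrix.fromBlocks_one]
  simp only [Matrix.mul_one, Matrix.mul_zero, Matrix.zero_mul, add_zero, zero_add,
    Matrix.diagonal_mul_diagonal, Int.cast_natCast]
  congr 1
  rw [← Matrix.diagonal_one]
  congr 1
  funext i
  exact inv_mul_cancel₀ (Nat.cast_ne_zero.2 (hδ i).ne')

/-- **The real representation in the type-`δ` marking is the `diag(1, Δ)`-conjugate of the one in the principal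
marking**: `ρ^δ(B) = ρ(diag(1,Δ) · B · diag(1,Δ)⁻¹)` as real-linear maps of `ℂ^g` (`Φ^δ_Z = Φ_Z ∘ diag(1, Δ)`).
[cite: Lange2023AbelianVarietiesComplex, §3.1.2 (3.2) (p0159)] -/
theorem analyticRepReal_siegelPeriodEquiv (Z : siegelUpperHalfSpace g) (B : Matrix (Fin g ⊕ Fin g) (Fin g ⊕ Fin g) ℝ) :
    analyticRepReal (siegelPeriodEquiv hδ Z.2) (siegelPeriodEquiv hδ Z.2) B =
      analyticRepReal (prinPeriod Z) (prinPeriod Z)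
        ((typeDiagInt δ).map (Int.cast : ℤ → ℝ) * B * Matrix.fromBlocks 1 0 0 (Matrix.diagonal fun i ↦ (δ i : ℝ)⁻¹)) := by
  apply ContinuousLinearMap.ext
  intro u
  obtain ⟨x, rfl⟩ := (siegelPeriodEquiv hδ Z.2).surjective u
  rw [analyticRepReal_apply, ← prinPeriod_typeDiagInt_mulVec hδ Z x, analyticRepReal_apply,
    ← prinPeriod_typeDiagInt_mulVec hδ Z, Matrix.mulVec_mulVec, Matrix.mulVec_mulVec, Matrix.mul_assoc,
    Matrix.mul_assoc, inv_mul_typeDiag hδ, Matrix.mul_one]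

/-- **`Sp(V, E)` in the type-`δ` marking is the `diag(1, Δ)⁻¹`-conjugate of `Sp_{2g}(ℝ)`** (the polarisation
`E_Z` is the same form on `ℂ^g` in both markings, `siegelForm_eq_prinForm`).
[cite: Lange2023AbelianVarietiesComplex, §3.1.2 (3.2)–(3.4) (p0159)] -/
theorem spGroup_siegelPeriodEquiv_eq_map (Z : siegelUpperHalfSpace g)
    (h1 : (typeDiagInt δ).map (Int.cast : ℤ → ℝ) * Matrix.fromBlocks 1 0 0 (Matrix.diagonal fun i ↦ (δ i : ℝ)⁻¹) = 1)
    (h2 : Matrix.fromBlocks 1 0 0 (Matrix.diagonal fun i ↦ (δ i : ℝ)⁻¹) * (typeDiagInt δ).map (Int.cast : ℤ → ℝ) = 1) :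
    spGroup (siegelPeriodEquiv hδ Z.2) (siegelForm hδ Z.2) =
      (spGroup (prinPeriod Z) (prinForm Z)).map
        (conjSL (Matrix.fromBlocks 1 0 0 (Matrix.diagonal fun i ↦ (δ i : ℝ)⁻¹)) ((typeDiagInt δ).map (Int.cast : ℤ → ℝ))
          h1 h2) := by
  rw [siegelForm_eq_prinForm hδ Z]
  ext M'
  rw [Subgroup.mem_map]
  constructor
  · intro hM'
    refine ⟨conjSL ((typeDiagInt δ).map (Int.cast : ℤ → ℝ)) (Matrix.fromBlocks 1 0 0 (Matrix.diagonal fun i ↦ (δ i : ℝ)⁻¹))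
      h2 h1 M', ?_, ?_⟩
    · rw [mem_spGroup_iff] at hM' ⊢
      intro u v
      rw [coe_conjSL, ← analyticRepReal_siegelPeriodEquiv hδ Z]
      exact hM' u v
    · apply Subtype.ext
      rw [coe_conjSL, coe_conjSL]
      calc Matrix.fromBlocks 1 0 0 (Matrix.diagonal fun i ↦ (δ i : ℝ)⁻¹) *
            ((typeDiagInt δ).map (Int.cast : ℤ → ℝ) * M'.1 * Matrix.fromBlocks 1 0 0 (Matrix.diagonal fun i ↦ (δ i : ℝ)⁻¹)) *
            (typeDiagInt δ).map (Int.cast : ℤ → ℝ)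
          = (Matrix.fromBlocks 1 0 0 (Matrix.diagonal fun i ↦ (δ i : ℝ)⁻¹) * (typeDiagInt δ).map (Int.cast : ℤ → ℝ)) * M'.1 *
            (Matrix.fromBlocks 1 0 0 (Matrix.diagonal fun i ↦ (δ i : ℝ)⁻¹) * (typeDiagInt δ).map (Int.cast : ℤ → ℝ)) := by
            simp only [Matrix.mul_assoc]
        _ = M'.1 := by rw [h2, Matrix.one_mul, Matrix.mul_one]
  · rintro ⟨M, hM, rfl⟩
    rw [mem_spGroup_iff] at hM ⊢
    intro u v
    rw [coe_conjSL, analyticRepReal_siegelPeriodEquiv hδ Z]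
    have hconj : (typeDiagInt δ).map (Int.cast : ℤ → ℝ) *
        (Matrix.fromBlocks 1 0 0 (Matrix.diagonal fun i ↦ (δ i : ℝ)⁻¹) * M.1 * (typeDiagInt δ).map (Int.cast : ℤ → ℝ)) *
        Matrix.fromBlocks 1 0 0 (Matrix.diagonal fun i ↦ (δ i : ℝ)⁻¹) = M.1 := by
      calc (typeDiagInt δ).map (Int.cast : ℤ → ℝ) *
            (Matrix.fromBlocks 1 0 0 (Matrix.diagonal fun i ↦ (δ i : ℝ)⁻¹) * M.1 * (typeDiagInt δ).map (Int.cast : ℤ → ℝ)) *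
            Matrix.fromBlocks 1 0 0 (Matrix.diagonal fun i ↦ (δ i : ℝ)⁻¹)
          = ((typeDiagInt δ).map (Int.cast : ℤ → ℝ) * Matrix.fromBlocks 1 0 0 (Matrix.diagonal fun i ↦ (δ i : ℝ)⁻¹)) * M.1 *
            ((typeDiagInt δ).map (Int.cast : ℤ → ℝ) * Matrix.fromBlocks 1 0 0 (Matrix.diagonal fun i ↦ (δ i : ℝ)⁻¹)) := by
            simp only [Matrix.mul_assoc]
        _ = M.1 := by rw [h1, Matrix.one_mul, Matrix.mul_one]
    rw [hconj]
    exact hM u v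

/-- **Prop. 7.3.2 is insensitive to the polarisation type**: at the same `Z ∈ 𝔥_g`, `Hg(X^δ_Z) = Sp(V, E)` iff
`Hg(X_Z) = Sp(V, E)` — both groups are the `diag(1, Δ)`-conjugates of their principal counterparts (isogeny
invariance of the Hodge group, tree `hodgeGroup_eq_map_conjSL`; `spGroup_siegelPeriodEquiv_eq_map`).
[cite: Lange2023AbelianVarietiesComplex, §7.3.1 Prop. 7.3.2 (p0336) and §7.3.3 Exercise (1)(a) (p0341)] -/
theorem hodgeGroup_eq_spGroup_type_iff (Z : siegelUpperHalfSpace g) :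
    hodgeGroup (siegelPeriodEquiv hδ Z.2) = spGroup (siegelPeriodEquiv hδ Z.2) (siegelForm hδ Z.2) ↔
      hodgeGroup (prinPeriod Z) = spGroup (prinPeriod Z) (prinForm Z) := by
  classical
  set Q : Matrix (Fin g ⊕ Fin g) (Fin g ⊕ Fin g) ℚ := Matrix.fromBlocks 1 0 0 (Matrix.diagonal fun i ↦ (δ i : ℚ)) with hQ
  set P : Matrix (Fin g ⊕ Fin g) (Fin g ⊕ Fin g) ℚ := Matrix.fromBlocks 1 0 0 (Matrix.diagonal fun i ↦ (δ i : ℚ)⁻¹)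
    with hP
  have hδ0 : ∀ i, (δ i : ℚ) ≠ 0 := fun i ↦ Nat.cast_ne_zero.2 (hδ i).ne'
  have hQP : Q * P = 1 := by
    rw [hQ, hP, Matrix.fromBlocks_multiply, ← Matrix.fromBlocks_one]
    simp only [Matrix.mul_one, Matrix.mul_zero, Matrix.zero_mul, add_zero, zero_add,
      Matrix.diagonal_mul_diagonal]
    congr 1
    rw [← Matrix.diagonal_one]
    congr 1
    funext i
    exact mul_inv_cancel₀ (hδ0 i)
  have hPQ : P * Q = 1 := by
    rw [hQ, hP, Matrix.fromBlocks_multiply, ← Matrix.fromBlocks_one]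
    simp only [Matrix.mul_one, Matrix.mul_zero, Matrix.zero_mul, add_zero, zero_add,
      Matrix.diagonal_mul_diagonal]
    congr 1
    rw [← Matrix.diagonal_one]
    congr 1
    funext i
    exact inv_mul_cancel₀ (hδ0 i)
  have hQR : Q.map (Rat.cast : ℚ → ℝ) = (typeDiagInt δ).map (Int.cast : ℤ → ℝ) := fromBlocks_diag_map_ratCast δ
  have hPR : P.map (Rat.cast : ℚ → ℝ) = Matrix.fromBlocks 1 0 0 (Matrix.diagonal fun i ↦ (δ i : ℝ)⁻¹) :=
    fromBlocks_diagInv_map_ratCast δ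
  -- `P = diag(1, Δ)⁻¹ ∈ Hom_ℚ(X_Z, X^δ_Z)` with analytic representation the identity
  have hPmem : P ∈ homRat (prinPeriod Z) (siegelPeriodEquiv hδ Z.2) := by
    rw [mem_homRat_iff_exists_analyticRep]
    refine ⟨ContinuousLinearMap.id ℂ (Fin g → ℂ), fun x ↦ ?_⟩
    rw [ContinuousLinearMap.id_apply, ← prinPeriod_typeDiagInt_mulVec hδ Z, Matrix.mulVec_mulVec, hPR,
      typeDiag_mul_inv hδ, Matrix.one_mulVec]
  have hHg := hodgeGroup_eq_map_conjSL hPmem hQP hPQ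
  have h1 : (typeDiagInt δ).map (Int.cast : ℤ → ℝ) * Matrix.fromBlocks 1 0 0 (Matrix.diagonal fun i ↦ (δ i : ℝ)⁻¹) = 1 :=
    typeDiag_mul_inv hδ
  have h2 : Matrix.fromBlocks 1 0 0 (Matrix.diagonal fun i ↦ (δ i : ℝ)⁻¹) * (typeDiagInt δ).map (Int.cast : ℤ → ℝ) = 1 :=
    inv_mul_typeDiag hδ
  have hSp := spGroup_siegelPeriodEquiv_eq_map hδ Z h1 h2
  rw [hHg, hSp]
  simp only [hQR, hPR]
  exact (Subgroup.map_injective (conjSL_injective _ _ h1 h2)).eq_iff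

/-- **Proposition 7.3.2 for the Siegel family of every type `δ`**: for `Z` off the meagre set `𝒩_Hg`,
`Hg(X^δ_Z) = Sp(V, E)`. [cite: Lange2023AbelianVarietiesComplex, §7.3.1 Prop. 7.3.2 (p0336)] -/
theorem hodgeGroup_eq_spGroup_of_not_mem_type {Z : siegelUpperHalfSpace g} (hZ : Z ∉ hodgeGroupExceptionalLocus g) :
    hodgeGroup (siegelPeriodEquiv hδ Z.2) = spGroup (siegelPeriodEquiv hδ Z.2) (siegelForm hδ Z.2) :=
  (hodgeGroup_eq_spGroup_type_iff hδ Z).2 (hodgeGroup_eq_spGroup_of_not_mem hZ)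

/-- `dim_ℂ ℂ^g = g`. [folklore] -/
private theorem finrank_fin_fun'' : Module.finrank ℂ (Fin g → ℂ) = g := by
  rw [Module.finrank_fintype_fun_eq_card, Fintype.card_fin]

/-- **Theorem 7.3.1 via Prop. 7.3.2 + Prop. 7.3.3, every type `δ`**: off `𝒩_Hg`, `H^{2p}_Hodge(X^δ_Z) = Dᵖ(X^δ_Z)`
and `dim_ℚ H^{2p}_Hodge(X^δ_Z) = 1` for `p ≤ g`.
[cite: Lange2023AbelianVarietiesComplex, §7.3.1 Thm. 7.3.1, Prop. 7.3.2, Prop. 7.3.3 (p0336–p0337)] -/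
theorem mattuck_type_of_not_mem_hodgeGroupExceptionalLocus {Z : siegelUpperHalfSpace g}
    (hZ : Z ∉ hodgeGroupExceptionalLocus g) {p : ℕ} (hp : p ≤ g) :
    hodgeClasses (siegelPeriodEquiv hδ Z.2) p = divisorClasses (siegelPeriodEquiv hδ Z.2) p ∧
      Module.finrank ℚ (hodgeClasses (siegelPeriodEquiv hδ Z.2) p) = 1 := by
  have hle : spGroup (siegelPeriodEquiv hδ Z.2) (siegelForm hδ Z.2) ≤ hodgeGroup (siegelPeriodEquiv hδ Z.2) :=
    (hodgeGroup_eq_spGroup_of_not_mem_type hδ hZ).symm.le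
  exact ⟨(isRiemannForm_siegelForm hδ Z.2).hodgeClasses_eq_divisorClasses_of_spGroup_le hle p,
    (isRiemannForm_siegelForm hδ Z.2).finrank_hodgeClasses_eq_one_of_spGroup_le hle
      (by rw [finrank_fin_fun'']; exact hp)⟩

end SiegelModuli

end Literature.AlgebraicGeometry.ModuliOfAbelianVarieties
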